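import Mathlib
import HarnessLib
import Summits.ValiantsHypothesis.ValiantsHypothesis.Theorems.MonotoneRestorationOrbitRestorationQPSmlNumeric
import Summits.ValiantsHypothesis.ValiantsHypothesis.Theorems.MonotoneRestorationOrbitRestorationQPSmlEquivariantForm
import Summits.ValiantsHypothesis.ValiantsHypothesis.Theorems.MonotoneRestorationOrbitRestorationQPDepthThreeRungDefs
import Summits.ValiantsHypothesis.ValiantsHypothesis.Theorems.MonotoneRestorationOrbitRestorationQPCircuitOfEquivariantTerms
import Summits.ValiantsHypothesis.ValiantsHypothesis.Theorems.MonotoneRestorationOrbitRestorationQPRestorable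
import Summits.ValiantsHypothesis.ValiantsHypothesis.Theorems.MonotoneRestorationOrbitRestorationQPValueOrbitRestoration

/-!
# THE SET-MULTILINEAR STRATUM OF A_∞: column-set-multilinear `ΣΠΣ` families are orbit-restorable
(crux `OrbitRestorationQP`, stmt-ValiantsHypothesis-18293 — lane SML, blueprint `SML-STRATUM-BLUEPRINT.md`)

**THEOREM `colSml_restoration`.**  Let `f` be a MATRIX-SYMMETRIC family (`IsMatrixSymmetric`, the hypothesis of the registered
stub `stub_sigmaPiSigmaValue` = A_∞) such that every `f n` is given by a COLUMN-SET-MULTILINEAR `ΣΠΣ` circuit with at most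
`n^c + c` product gates: `f n = Σ_{t<s} Π_{b<n} (Σ_a α_{t,b,a} x_{(a,b)})`, `s ≤ n^c + c`.  Then `f` is quasi-polynomially (indeed
polynomially) ORBIT-RESTORABLE: `∃ c', ∀ n, QPOrbitRestorable c' n (f n)`.

This is an unconditional stratum of A_∞ defined by a CIRCUIT MODEL, with cancellations allowed (the given circuit need not be
symmetric or identifiable).  Proof: flattening rank `≤ s` (chain rule + column symmetry) ⇒ by the Johnson rank lemma and the
narrowness theorem the symmetric form `p = f n (x_{ab} ↦ y_a)` has `(c+1)`-narrow power-sum support once `n^c + c < C(n-c-2, c+2)`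
⇒ grid interpolation + injectivity give the EQUIVARIANT NORMAL FORM `f n = Σ_{τ,g} d_τ Π_b (C_b + Σ_i τ_i x_{(g i, b)})`
(`…SmlEquivariantForm`), an `S_n`-stable multiset of `(n+1)^{c+1} n^{c+1}` products of affine forms (`IsEquivariantTerms`) ⇒ the
landed stub B `stub_circuitOfEquivariantTerms` gives the symmetric circuit; small `n` by `Restorable.qpOrbitRestorable_of_invariant`.
Honest label: a stratum of the off-path sub-rung A_∞; the stub itself (all of `PDClass 1`) is not closed. [folklore]
-/

set_option linter.dupNamespace false

namespace Summit.ValiantsHypothesis.ValiantsHypothesis.Theorems.SmlRestoration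

open MvPolynomial Finset OrbitRestorationQPDepthThreeRung SmlNumeric SmlEquivariantForm

/-- A quasi-polynomial bound for `(n+1)^{2w}`. [folklore] -/
theorem succ_pow_le_qp (w : ℕ) : ∀ n : ℕ, (n + 1) ^ (2 * w) ≤ 2 ^ ((Nat.log 2 n + (2 * w + 2)) ^ (2 * w + 2)) := by
  intro n
  have hL : n + 1 ≤ 2 ^ (Nat.log 2 n + 1) := Nat.lt_pow_succ_log_self Nat.one_lt_two n
  calc (n + 1) ^ (2 * w) ≤ (2 ^ (Nat.log 2 n + 1)) ^ (2 * w) := Nat.pow_le_pow_left hL _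
    _ = 2 ^ ((Nat.log 2 n + 1) * (2 * w)) := (pow_mul _ _ _).symm
    _ ≤ 2 ^ ((Nat.log 2 n + (2 * w + 2)) ^ (2 * w + 2)) := by
        refine Nat.pow_le_pow_right (by norm_num) ?_
        calc (Nat.log 2 n + 1) * (2 * w) ≤ (Nat.log 2 n + (2 * w + 2)) * (Nat.log 2 n + (2 * w + 2)) :=
              Nat.mul_le_mul (by omega) (by omega)
          _ = (Nat.log 2 n + (2 * w + 2)) ^ 2 := (sq _).symm
          _ ≤ (Nat.log 2 n + (2 * w + 2)) ^ (2 * w + 2) := Nat.pow_le_pow_right (by omega) (by omega)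

/-- The diagonal action renames a generating factor of column `b` for rows `g` into the generating factor of column `σ b` for
rows `σ ∘ g`. [folklore] -/
theorem rename_diag_genFactor {n w : ℕ} (σ : Equiv.Perm (Fin n)) (τ : Fin w → Fin (n + 1)) (g : Fin w → Fin n) (b : Fin n) :
    rename (fun pq : Fin n × Fin n => σ • pq)
        (∑ a : Fin n, C (1 + ∑ i : Fin w, if g i = a then ((τ i : ℕ) : ℂ) else 0) * X (a, b) : MvPolynomial (Fin n × Fin n) ℂ) =
      ∑ a : Fin n, C (1 + ∑ i : Fin w, if σ (g i) = a then ((τ i : ℕ) : ℂ) else 0) * X (a, σ b) := by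
  simp only [map_sum, map_mul, rename_C, rename_X, Prod.smul_mk, Equiv.Perm.smul_def]
  symm
  rw [← Equiv.sum_comp σ]
  refine Finset.sum_congr rfl fun a _ => ?_
  simp only [σ.injective.eq_iff]

/-- Re-indexing a map over `univ` by a permutation of the index type. [folklore] -/
theorem map_univ_comp_equiv {α β : Type*} [Fintype α] (e : α ≃ α) (F : α → β) :
    ((Finset.univ : Finset α).val.map fun x => F (e x)) = (Finset.univ : Finset α).val.map F := by
  conv_rhs => rw [← Multiset.map_univ_val_equiv e, Multiset.map_map]
  rfl

/-- **THE SET-MULTILINEAR STRATUM OF A_∞.**  A matrix-symmetric family with column-set-multilinear `ΣΠΣ` circuits of at most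
`n^c + c` product gates is quasi-polynomially orbit-restorable. [folklore] -/
theorem colSml_restoration :
    ∀ f : (n : ℕ) → MvPolynomial (Fin n × Fin n) ℂ, IsMatrixSymmetric f →
      (∃ c : ℕ, ∀ n : ℕ, ∃ (s : ℕ) (α : Fin s → Fin n → Fin n → ℂ), s ≤ n ^ c + c ∧
        f n = ∑ t : Fin s, ∏ b : Fin n, ∑ a : Fin n, C (α t b a) * X (a, b)) →
      ∃ c' : ℕ, ∀ n : ℕ, QPOrbitRestorable c' n (f n) := by
  intro f hsym ⟨c, hcirc⟩
  classical
  -- large `n`: the equivariant normal form with `w = c + 1` slots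
  obtain ⟨N₀, hN₀⟩ := exists_pow_add_lt_choose c
  set N₁ := max N₀ (2 * c + 4) with hN₁
  have hform : ∀ n, N₁ ≤ n → ∃ d : (Fin (c + 1) → Fin (n + 1)) → ℂ,
      f n = ∑ τg : (Fin (c + 1) → Fin (n + 1)) × (Fin (c + 1) → Fin n), C (d τg.1) *
        ∏ b : Fin n, ∑ a : Fin n, C (1 + ∑ i : Fin (c + 1), if τg.2 i = a then ((τg.1 i : ℕ) : ℂ) else 0) * X (a, b) := by
    intro n hn
    obtain ⟨s, α, hs, hf⟩ := hcirc n
    have hrow : ∀ σ : Equiv.Perm (Fin n), rename (fun v : Fin n × Fin n => (σ v.1, v.2))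
        (∑ t : Fin s, ∏ b : Fin n, ∑ a : Fin n, C (α t b a) * X (a, b) : MvPolynomial (Fin n × Fin n) ℂ) =
        ∑ t : Fin s, ∏ b : Fin n, ∑ a : Fin n, C (α t b a) * X (a, b) := by
      intro σ; rw [← hf]; simpa using hsym n σ 1
    have hcol : ∀ τ : Equiv.Perm (Fin n), rename (fun v : Fin n × Fin n => (v.1, τ v.2))
        (∑ t : Fin s, ∏ b : Fin n, ∑ a : Fin n, C (α t b a) * X (a, b) : MvPolynomial (Fin n × Fin n) ℂ) =
        ∑ t : Fin s, ∏ b : Fin n, ∑ a : Fin n, C (α t b a) * X (a, b) := by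
      intro τ; rw [← hf]; simpa using hsym n 1 τ
    have hlt : s < Nat.choose (n - (c + 1 + 1)) (c + 1 + 1) :=
      lt_of_le_of_lt hs (hN₀ n (le_trans (le_max_left _ _) hn))
    obtain ⟨d, hd⟩ := exists_equivariant_form (w := c + 1) (by omega) α hrow hcol hlt
    exact ⟨d, hf.trans hd⟩
  choose d hd using hform
  -- the term multisets
  let T : (n : ℕ) → Multiset (Multiset (MvPolynomial (Fin n × Fin n) ℂ)) := fun n =>
    if h : N₁ ≤ n then
      (Finset.univ : Finset ((Fin (c + 1) → Fin (n + 1)) × (Fin (c + 1) → Fin n))).val.map fun τg =>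
        C (d n h τg.1) ::ₘ (Finset.univ : Finset (Fin n)).val.map fun b =>
          ∑ a : Fin n, C (1 + ∑ i : Fin (c + 1), if τg.2 i = a then ((τg.1 i : ℕ) : ℂ) else 0) * X (a, b)
    else 0
  have hT : ∀ n, IsEquivariantTerms n (2 * (c + 1) + 2) (T n) := by
    intro n
    by_cases h : N₁ ≤ n
    · have hbound : (n + 1) ^ (2 * (c + 1)) ≤ 2 ^ ((Nat.log 2 n + (2 * (c + 1) + 2)) ^ (2 * (c + 1) + 2)) :=
        succ_pow_le_qp (c + 1) n
      simp only [T, dif_pos h]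
      refine ⟨?_, ?_, ?_, ?_⟩
      · -- degrees
        intro m hm ℓ hℓ
        obtain ⟨τg, _, rfl⟩ := Multiset.mem_map.1 hm
        rcases Multiset.mem_cons.1 hℓ with rfl | hℓ
        · rw [totalDegree_C]; exact Nat.zero_le _
        · obtain ⟨b, _, rfl⟩ := Multiset.mem_map.1 hℓ
          refine totalDegree_finsetSum_le fun a _ => ?_
          calc (C (1 + ∑ i : Fin (c + 1), if τg.2 i = a then ((τg.1 i : ℕ) : ℂ) else 0) * X (a, b) :
                MvPolynomial (Fin n × Fin n) ℂ).totalDegree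
              ≤ (C (1 + ∑ i : Fin (c + 1), if τg.2 i = a then ((τg.1 i : ℕ) : ℂ) else 0) :
                  MvPolynomial (Fin n × Fin n) ℂ).totalDegree + (X (a, b) : MvPolynomial (Fin n × Fin n) ℂ).totalDegree :=
                totalDegree_mul _ _
            _ ≤ 1 := by rw [totalDegree_C, totalDegree_X]
      · -- number of terms
        rw [Multiset.card_map, Finset.card_val, Finset.card_univ, Fintype.card_prod, Fintype.card_fun, Fintype.card_fun,
          Fintype.card_fin, Fintype.card_fin, Fintype.card_fin]
        refine le_trans ?_ hbound
        calc (n + 1) ^ (c + 1) * n ^ (c + 1) ≤ (n + 1) ^ (c + 1) * (n + 1) ^ (c + 1) :=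
              Nat.mul_le_mul_left _ (Nat.pow_le_pow_left (by omega) _)
          _ = (n + 1) ^ (2 * (c + 1)) := by rw [← pow_add]; ring_nf
      · -- number of factors per term
        intro m hm
        obtain ⟨τg, _, rfl⟩ := Multiset.mem_map.1 hm
        rw [Multiset.card_cons, Multiset.card_map, Finset.card_val, Finset.card_univ, Fintype.card_fin]
        refine le_trans ?_ hbound
        calc n + 1 = (n + 1) ^ 1 := (pow_one _).symm
          _ ≤ (n + 1) ^ (2 * (c + 1)) := Nat.pow_le_pow_right (by omega) (by omega)
      · -- stability under the diagonal action
        intro σ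
        rw [Multiset.map_map]
        have hterm : ∀ τg : (Fin (c + 1) → Fin (n + 1)) × (Fin (c + 1) → Fin n),
            ((Multiset.map fun ℓ => rename (fun pq : Fin n × Fin n => σ • pq) ℓ) ∘ fun τg =>
              C (d n h τg.1) ::ₘ (Finset.univ : Finset (Fin n)).val.map fun b =>
                ∑ a : Fin n, C (1 + ∑ i : Fin (c + 1), if τg.2 i = a then ((τg.1 i : ℕ) : ℂ) else 0) * X (a, b)) τg =
            C (d n h τg.1) ::ₘ (Finset.univ : Finset (Fin n)).val.map fun b =>
              ∑ a : Fin n, C (1 + ∑ i : Fin (c + 1), if σ (τg.2 i) = a then ((τg.1 i : ℕ) : ℂ) else 0) * X (a, b) := by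
          intro τg
          simp only [Function.comp_apply, Multiset.map_cons, rename_C, Multiset.map_map]
          congr 1
          rw [Multiset.map_congr rfl (fun b _ => rename_diag_genFactor σ τg.1 τg.2 b)]
          exact map_univ_comp_equiv σ (fun b => ∑ a : Fin n,
            C (1 + ∑ i : Fin (c + 1), if σ (τg.2 i) = a then ((τg.1 i : ℕ) : ℂ) else 0) * X (a, b))
        rw [Multiset.map_congr rfl (fun τg _ => hterm τg)]
        exact map_univ_comp_equiv (Equiv.prodCongr (Equiv.refl _) (Equiv.arrowCongr (Equiv.refl (Fin (c + 1))) σ))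
          (fun τg : (Fin (c + 1) → Fin (n + 1)) × (Fin (c + 1) → Fin n) =>
            C (d n h τg.1) ::ₘ (Finset.univ : Finset (Fin n)).val.map fun b =>
              ∑ a : Fin n, C (1 + ∑ i : Fin (c + 1), if τg.2 i = a then ((τg.1 i : ℕ) : ℂ) else 0) * X (a, b))
    · simp only [T, dif_neg h]
      refine ⟨by simp, by simp, by simp, fun σ => by simp⟩
  obtain ⟨c₁, hc₁⟩ := stub_circuitOfEquivariantTerms T (2 * (c + 1) + 2) hT
  -- the value of the term multisets for large `n`
  have hval : ∀ n, N₁ ≤ n → ((T n).map Multiset.prod).sum = f n := by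
    intro n h
    simp only [T, dif_pos h, Multiset.map_map]
    rw [hd n h, Finset.sum_eq_multiset_sum]
    refine congrArg _ (Multiset.map_congr rfl fun τg _ => ?_)
    simp only [Function.comp_apply, Multiset.prod_cons, Finset.prod_eq_multiset_prod]
  refine ⟨max c₁ (N₁.factorial + 5), fun n => ?_⟩
  by_cases h : N₁ ≤ n
  · exact Restorable.qpOrbitRestorable_mono (le_max_left _ _) ((hval n h) ▸ hc₁ n)
  · have hinv : ∀ σ : Equiv.Perm (Fin n), ren σ (f n) = f n := fun σ => ValueOrbit.ren_eq_of_matrixSymmetric (hsym n) σ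
    have h1 := Restorable.qpOrbitRestorable_of_invariant (f n) hinv
    refine Restorable.qpOrbitRestorable_mono ?_ h1
    have : n.factorial ≤ N₁.factorial := Nat.factorial_le (by omega)
    omega

end Summit.ValiantsHypothesis.ValiantsHypothesis.Theorems.SmlRestoration
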